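import Mathlib
import Literature.Probability.Percolation.Percolation
import Literature.Probability.Percolation.DiagonalStripColumns
import Literature.Probability.Percolation.DiagonalColumnPatterns
import Literature.Probability.Percolation.DiagonalStripTransferExplicit
import Literature.Probability.Percolation.DiagonalStripTransferInhomogeneous
import Literature.Probability.Percolation.DiagonalStripTLAction
import Literature.Probability.Percolation.DiagonalStripTLActionFork
import Literature.Probability.LatticeModels.TemperleyLiebBaxterization
import HarnessLib

/-!
# The single-row interlacing relation of Ikhlef–Ponsaing's transfer matrix (cluster language)

Topic `Literature/Probability/Percolation`. Ikhlef–Ponsaing (J. Stat. Phys. 149 (2012),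
arXiv:1202.5476) Lemma 3.2: `t(w; …, z_i, z_{i+1}, …)` and `Ř_i(z_i/z_{i+1})` interlace (proof: the
Yang–Baxter equation pushed through the two rows). In the cluster language of
`DiagonalStripTransferInhomogeneous.lean` one row is the weighted layer kernel `ipTransferW m c p`,
`Ř_i(x) = ([q/x] - [x] e_i)/[qx]`, and `e_i` acts on column patterns by `cpIsolate` / `cpJoin`
(`DiagonalStripTLAction.lean`). This file proves the ONE-ROW interlacing identity in kernel form,
`α (T_p - T_{p'})(P → P'') = β ((T_p ∘ e^{out})(P → P'') - T_{p'}(e^{in} P → P''))`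
(`α = [q/x]`, `β = [x]`, `p'` = the weights with the two rapidities at the site exchanged), at a level
hosting a new site (**`ipTransferW_interlace_bridge`**, `e^{out} = iso_j`, `e^{in} = join_{uL uR}`)
and at a level hosting an old site (**`ipTransferW_interlace_fork`**, `e^{out} = join_{nL nR}`,
`e^{in} = iso_v`), for ARBITRARY edge weights that agree off the two edges at the site, are
swapped-and-complemented on them, and satisfy one scalar identity; and it proves that scalar
identity for IP12's tile weights: **`ipWt_exchange_identity`**
(`[qb/a](A(a)B(b) - A(b)B(a)) + [a/b](1 - A(a)B(b)) = 0` for `q³ = 1`), to which all four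
(row, parity) combinations reduce because `A + B = 1`.

Tools: `sum_powerset_bridge_decomp` / `sum_powerset_fork_decomp` (split the sum over edge sets off
the two edges at a site), `edgeFn_insert`, `setEdge_eq_self`, `ipTransferW_eq_sum_boole`,
`sum_filter_ipTransferW_eq`, `qbr_exchange_identity`.

What is NOT here: the assembly of the two rows into the interlacing of `ipTransferMatrixW` on lumped
states, the boundary reflections `z_1 → 1/z_1`, `z_L → 1/z_L`, and `[t(w), t(w')] = 0`.

## References

* Y. Ikhlef, A. K. Ponsaing, J. Stat. Phys. 149 (2012) 10–36, arXiv:1202.5476, Def. 3.1, Lemma 3.2.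
  [IkhlefPonsaing2012]
-/

namespace Literature.Probability.Percolation

open Literature.Probability.LatticeModels Literature.Probability.LatticeModels.TemperleyLieb

variable {m : ℕ}

/-! ### Edge layers with prescribed edges -/

section EdgeFn

variable {c : ℤ}

/-- Prescribing an edge that already has the prescribed value does nothing. [folklore] -/
theorem setEdge_eq_self {E : Fin (m + 1) → Fin (m + 1) → Bool} {i j : Fin (m + 1)} {b : Bool}
    (h : E i j = b) : setEdge E i j b = E := by
  funext i' j'
  unfold setEdge
  split_ifs with h'
  · rw [h'.1, h'.2, h]
  · rfl

/-- Inserting the pair `(a, b)` sets the edge `(a, b)`. [folklore] -/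
theorem edgeFn_insert (c : ℤ) (U : Finset (Sym2 (Site 2))) (a b : Fin (m + 1)) :
    edgeFn m c (insert s(colSite c a, colSite (c + 1) b) U) = setEdge (edgeFn m c U) a b true := by
  classical
  funext i j'
  simp only [edgeFn, setEdge]
  by_cases h : i = a ∧ j' = b
  · rw [if_pos h, h.1, h.2]; simp
  · rw [if_neg h]
    have hne : s(colSite c (i : ℕ), colSite (c + 1) (j' : ℕ)) ≠ s(colSite c (a : ℕ), colSite (c + 1) (b : ℕ)) := by
      intro h'
      have := mk_colSite_injective (m := m) c (a₁ := (i, j')) (a₂ := (a, b)) h'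
      exact h ⟨(Prod.ext_iff.1 this).1, (Prod.ext_iff.1 this).2⟩
    rw [decide_eq_decide]
    simp [Finset.mem_insert, hne]

end EdgeFn

/-! ### The bridge decomposition of a weighted layer sum -/

section BridgeDecomp

variable {K : Type*} [Field K] {c : ℤ} {uL uR j : Fin (m + 1)}

/-- **Splitting off the two edges at a new site.** For any coefficient `Φ` of the edge layer, the
weighted sum over the edge sets of the layer is the sum over the edge sets `t` avoiding the two bridge
edges of the rest weight of `t` times the four bridge terms. [folklore] -/
theorem sum_powerset_bridge_decomp (hne : uL ≠ uR)
    (hL : s(colSite c uL, colSite (c + 1) j) ∈ latticeLayer m c)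
    (hR : s(colSite c uR, colSite (c + 1) j) ∈ latticeLayer m c)
    (honly : ∀ i : Fin (m + 1), s(colSite c i, colSite (c + 1) j) ∈ latticeLayer m c → i = uL ∨ i = uR)
    (p : Sym2 (Site 2) → K) (Φ : (Fin (m + 1) → Fin (m + 1) → Bool) → K) :
    ∑ U ∈ (latticeLayer m c).powerset,
        Φ (edgeFn m c U) * ((∏ e ∈ U, p e) * ∏ e ∈ latticeLayer m c \ U, (1 - p e)) =
      ∑ t ∈ (((latticeLayer m c).erase s(colSite c uL, colSite (c + 1) j)).erase
          s(colSite c uR, colSite (c + 1) j)).powerset,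
        ((∏ e ∈ t, p e) * ∏ e ∈ (((latticeLayer m c).erase s(colSite c uL, colSite (c + 1) j)).erase
          s(colSite c uR, colSite (c + 1) j)) \ t, (1 - p e)) *
        (Φ (bridgeSiteEdges (edgeFn m c t) uL uR j true true) *
            (p s(colSite c uL, colSite (c + 1) j) * p s(colSite c uR, colSite (c + 1) j)) +
          Φ (bridgeSiteEdges (edgeFn m c t) uL uR j true false) *
            (p s(colSite c uL, colSite (c + 1) j) * (1 - p s(colSite c uR, colSite (c + 1) j))) +
          Φ (bridgeSiteEdges (edgeFn m c t) uL uR j false true) *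
            ((1 - p s(colSite c uL, colSite (c + 1) j)) * p s(colSite c uR, colSite (c + 1) j)) +
          Φ (edgeFn m c t) *
            ((1 - p s(colSite c uL, colSite (c + 1) j)) * (1 - p s(colSite c uR, colSite (c + 1) j)))) := by
  classical
  set eL := s(colSite c (uL : ℕ), colSite (c + 1) (j : ℕ)) with heL
  set eR := s(colSite c (uR : ℕ), colSite (c + 1) (j : ℕ)) with heR
  set rest := ((latticeLayer m c).erase eL).erase eR with hrest
  have hLR : eL ≠ eR := fun h => hne (Prod.ext_iff.1 (mk_colSite_injective (m := m) c
    (a₁ := (uL, j)) (a₂ := (uR, j)) h)).1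
  have heRrest : eR ∉ rest := Finset.notMem_erase _ _
  have heLrest : eL ∉ rest := fun h => (Finset.mem_erase.1 (Finset.mem_erase.1 h).2).1 rfl |>.elim
  have heLrest' : eL ∉ insert eR rest := by simp [hLR, heLrest]
  have hlayer : latticeLayer m c = insert eL (insert eR rest) := by
    rw [hrest, Finset.insert_erase (Finset.mem_erase.2 ⟨hLR.symm, hR⟩), Finset.insert_erase hL]
  -- no edge of `rest` at `j`
  have hrest_j : ∀ t ⊆ rest, ∀ i : Fin (m + 1), edgeFn m c t i j = false := by
    intro t ht i
    simp only [edgeFn, decide_eq_false_iff_not]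
    intro hmem
    have hl : s(colSite c (i : ℕ), colSite (c + 1) (j : ℕ)) ∈ latticeLayer m c := by
      have := ht hmem
      rw [hrest] at this
      exact Finset.mem_of_mem_erase (Finset.mem_of_mem_erase this)
    have ht' := ht hmem
    rw [hrest] at ht'
    rcases honly i hl with rfl | rfl
    · exact (Finset.mem_erase.1 (Finset.mem_erase.1 ht').2).1 rfl
    · exact (Finset.mem_erase.1 ht').1 rfl
  rw [hlayer, Finset.sum_powerset_insert (β := K) heLrest', Finset.sum_powerset_insert (β := K) heRrest,
    Finset.sum_powerset_insert (β := K) heRrest, ← Finset.sum_add_distrib, ← Finset.sum_add_distrib,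
    ← Finset.sum_add_distrib]
  refine Finset.sum_congr rfl fun t ht => ?_
  have hts : t ⊆ rest := Finset.mem_powerset.1 ht
  have heLt : eL ∉ t := fun h => heLrest (hts h)
  have heRt : eR ∉ t := fun h => heRrest (hts h)
  have heLt' : eL ∉ insert eR t := by simp [hLR, heLt]
  have hB : IsBridgeSite (edgeFn m c t) uL uR j := ⟨hne, hrest_j t hts⟩
  -- the four edge layers
  have e_tt : edgeFn m c (insert eL (insert eR t)) = bridgeSiteEdges (edgeFn m c t) uL uR j true true := by
    rw [Finset.insert_comm, heR, edgeFn_insert, heL, edgeFn_insert]; rfl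
  have e_tf : edgeFn m c (insert eL t) = bridgeSiteEdges (edgeFn m c t) uL uR j true false := by
    rw [heL, edgeFn_insert]
    unfold bridgeSiteEdges
    refine (setEdge_eq_self ?_).symm
    rw [setEdge_of_ne _ _ (fun h => hne h.1.symm)]
    exact hB.noEdge uR
  have e_ft : edgeFn m c (insert eR t) = bridgeSiteEdges (edgeFn m c t) uL uR j false true := by
    rw [heR, edgeFn_insert]
    unfold bridgeSiteEdges
    rw [setEdge_eq_self (hB.noEdge uL)]
  -- the four complements
  have s_tt : insert eL (insert eR rest) \ insert eL (insert eR t) = rest \ t := by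
    ext e
    simp only [Finset.mem_sdiff, Finset.mem_insert]
    constructor
    · rintro ⟨h1, h2⟩
      simp only [not_or] at h2
      exact ⟨h1.resolve_left h2.1 |>.resolve_left h2.2.1, h2.2.2⟩
    · rintro ⟨h1, h2⟩
      refine ⟨Or.inr (Or.inr h1), ?_⟩
      rintro (rfl | rfl | h)
      · exact heLrest h1
      · exact heRrest h1
      · exact h2 h
  have s_tf : insert eL (insert eR rest) \ insert eL t = insert eR (rest \ t) := by
    ext e
    simp only [Finset.mem_sdiff, Finset.mem_insert]
    constructor
    · rintro ⟨h1, h2⟩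
      simp only [not_or] at h2
      rcases h1 with rfl | rfl | h1
      · exact absurd rfl h2.1
      · exact Or.inl rfl
      · exact Or.inr ⟨h1, h2.2⟩
    · rintro (rfl | ⟨h1, h2⟩)
      · exact ⟨Or.inr (Or.inl rfl), by rintro (h | h); exact hLR h.symm; exact heRt h⟩
      · refine ⟨Or.inr (Or.inr h1), ?_⟩
        rintro (rfl | h)
        · exact heLrest h1
        · exact h2 h
  have s_ft : insert eL (insert eR rest) \ insert eR t = insert eL (rest \ t) := by
    ext e
    simp only [Finset.mem_sdiff, Finset.mem_insert]
    constructor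
    · rintro ⟨h1, h2⟩
      simp only [not_or] at h2
      rcases h1 with rfl | rfl | h1
      · exact Or.inl rfl
      · exact absurd rfl h2.1
      · exact Or.inr ⟨h1, h2.2⟩
    · rintro (rfl | ⟨h1, h2⟩)
      · exact ⟨Or.inl rfl, by rintro (h | h); exact hLR h; exact heLt h⟩
      · refine ⟨Or.inr (Or.inr h1), ?_⟩
        rintro (rfl | h)
        · exact heRrest h1
        · exact h2 h
  have s_ff : insert eL (insert eR rest) \ t = insert eL (insert eR (rest \ t)) := by
    ext e
    simp only [Finset.mem_sdiff, Finset.mem_insert]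
    constructor
    · rintro ⟨rfl | rfl | h1, h2⟩
      · exact Or.inl rfl
      · exact Or.inr (Or.inl rfl)
      · exact Or.inr (Or.inr ⟨h1, h2⟩)
    · rintro (rfl | rfl | ⟨h1, h2⟩)
      · exact ⟨Or.inl rfl, heLt⟩
      · exact ⟨Or.inr (Or.inl rfl), heRt⟩
      · exact ⟨Or.inr (Or.inr h1), h2⟩
  have heRrt : eR ∉ rest \ t := fun h => heRrest (Finset.mem_sdiff.1 h).1
  have heLrt : eL ∉ rest \ t := fun h => heLrest (Finset.mem_sdiff.1 h).1
  have heLrt' : eL ∉ insert eR (rest \ t) := by simp [hLR, heLrt]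
  rw [e_tt, e_tf, e_ft, s_tt, s_tf, s_ft, s_ff, Finset.prod_insert heLt', Finset.prod_insert heRt,
    Finset.prod_insert heLt, Finset.prod_insert heLrt', Finset.prod_insert heRrt, Finset.prod_insert heLrt]
  ring

end BridgeDecomp

/-! ### Single-row interlacing at a new site (case I) -/

section InterlaceBridge

variable {K : Type*} [Field K] {c : ℤ} {uL uR j : Fin (m + 1)}

/-- The weighted kernel as a `Φ`-weighted layer sum (indicator coefficient). [folklore] -/
theorem ipTransferW_eq_sum_boole (c : ℤ) (p : Sym2 (Site 2) → K) (P P' : ColPattern m) :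
    ipTransferW m c p P P' = ∑ U ∈ (latticeLayer m c).powerset,
      (if colUpdate m c P (edgeFn m c U) = P' then (1 : K) else 0) *
        ((∏ e ∈ U, p e) * ∏ e ∈ latticeLayer m c \ U, (1 - p e)) := by
  unfold ipTransferW
  refine Finset.sum_congr rfl fun U _ => ?_
  rw [boole_mul]

/-- The kernel followed by a deterministic map `g` on the output, as a layer sum. [folklore] -/
theorem sum_filter_ipTransferW_eq (c : ℤ) (p : Sym2 (Site 2) → K) (P P'' : ColPattern m)
    (g : ColPattern m → ColPattern m) :
    ∑ P' ∈ Finset.univ.filter (fun P' => g P' = P''), ipTransferW m c p P P' =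
      ∑ U ∈ (latticeLayer m c).powerset,
        (if g (colUpdate m c P (edgeFn m c U)) = P'' then (1 : K) else 0) *
          ((∏ e ∈ U, p e) * ∏ e ∈ latticeLayer m c \ U, (1 - p e)) := by
  unfold ipTransferW
  rw [Finset.sum_comm]
  refine Finset.sum_congr rfl fun U _ => ?_
  rw [Finset.sum_ite_eq, boole_mul]
  simp only [Finset.mem_filter, Finset.mem_univ, true_and]

/-- **Single-row interlacing at a new site (case I), kernel form.** Let the new site `j` of the
layer `c → c+1` have the old neighbours `uL ≠ uR` and no other lattice edge, and let it not be the
wall site. For edge weights `p, p'` that agree off the two edges at `j` and are swapped-and-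
complemented on them (`p' e_L = 1 - p e_R`, `p' e_R = 1 - p e_L`), and scalars with
`α (p_L p_R - (1-p_L)(1-p_R)) + β (1 - p_L p_R) = 0`, one has, for every reflexive input pattern `P`
and every output pattern `P''`,
`α (T_p - T_{p'})(P → P'') = β ( (T_p ∘ iso_j)(P → P'') - T_{p'}(join_{uL uR} P → P'') )`
— the matrix identity `Ř^{out}(x) T(z) = T(s_i z) Ř^{in}(x)` of Ikhlef–Ponsaing's Lemma 3.2 for one
row, at a level hosting a new site. [cite: IkhlefPonsaing2012, Lemma 3.2] -/
theorem ipTransferW_interlace_bridge (hne : uL ≠ uR)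
    (hL : s(colSite c uL, colSite (c + 1) j) ∈ latticeLayer m c)
    (hR : s(colSite c uR, colSite (c + 1) j) ∈ latticeLayer m c)
    (honly : ∀ i : Fin (m + 1), s(colSite c i, colSite (c + 1) j) ∈ latticeLayer m c → i = uL ∨ i = uR)
    (hWj : ¬ ((c + 1) % 2 = 0 ∧ (j : ℕ) = 0)) {P : ColPattern m} (hP : ∀ i, P.1 i i = true)
    {p p' : Sym2 (Site 2) → K}
    (hpp' : ∀ e ∈ latticeLayer m c, e ≠ s(colSite c uL, colSite (c + 1) j) →
      e ≠ s(colSite c uR, colSite (c + 1) j) → p' e = p e)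
    (hL' : p' s(colSite c uL, colSite (c + 1) j) = 1 - p s(colSite c uR, colSite (c + 1) j))
    (hR' : p' s(colSite c uR, colSite (c + 1) j) = 1 - p s(colSite c uL, colSite (c + 1) j))
    {α β : K}
    (hαβ : α * (p s(colSite c uL, colSite (c + 1) j) * p s(colSite c uR, colSite (c + 1) j) -
        (1 - p s(colSite c uL, colSite (c + 1) j)) * (1 - p s(colSite c uR, colSite (c + 1) j))) +
      β * (1 - p s(colSite c uL, colSite (c + 1) j) * p s(colSite c uR, colSite (c + 1) j)) = 0)
    (P'' : ColPattern m) :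
    α * (ipTransferW m c p P P'' - ipTransferW m c p' P P'') =
      β * ((∑ P' ∈ Finset.univ.filter (fun P' => cpIsolate j P' = P''), ipTransferW m c p P P') -
        ipTransferW m c p' (cpJoin uL uR P) P'') := by
  rw [ipTransferW_eq_sum_boole c p P, ipTransferW_eq_sum_boole c p' P, ipTransferW_eq_sum_boole c p',
    sum_filter_ipTransferW_eq,
    sum_powerset_bridge_decomp hne hL hR honly p (fun E => if colUpdate m c P E = P'' then (1 : K) else 0),
    sum_powerset_bridge_decomp hne hL hR honly p' (fun E => if colUpdate m c P E = P'' then (1 : K) else 0),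
    sum_powerset_bridge_decomp hne hL hR honly p
      (fun E => if cpIsolate j (colUpdate m c P E) = P'' then (1 : K) else 0),
    sum_powerset_bridge_decomp hne hL hR honly p'
      (fun E => if colUpdate m c (cpJoin uL uR P) E = P'' then (1 : K) else 0),
    ← Finset.sum_sub_distrib, ← Finset.sum_sub_distrib, Finset.mul_sum, Finset.mul_sum]
  set eL := s(colSite c (uL : ℕ), colSite (c + 1) (j : ℕ)) with heL
  set eR := s(colSite c (uR : ℕ), colSite (c + 1) (j : ℕ)) with heR
  set rest := ((latticeLayer m c).erase eL).erase eR with hrest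
  refine Finset.sum_congr rfl fun t ht => ?_
  have hts : t ⊆ rest := Finset.mem_powerset.1 ht
  -- no edge of `t` at `j`
  have hB : IsBridgeSite (edgeFn m c t) uL uR j := by
    refine ⟨hne, fun i => ?_⟩
    simp only [edgeFn, decide_eq_false_iff_not]
    intro hmem
    have ht' := hts hmem
    rw [hrest] at ht'
    have hl : s(colSite c (i : ℕ), colSite (c + 1) (j : ℕ)) ∈ latticeLayer m c :=
      Finset.mem_of_mem_erase (Finset.mem_of_mem_erase ht')
    rcases honly i hl with rfl | rfl
    · exact (Finset.mem_erase.1 (Finset.mem_erase.1 ht').2).1 rfl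
    · exact (Finset.mem_erase.1 ht').1 rfl
  -- the weights of `t` agree
  have hw : ((∏ e ∈ t, p' e) * ∏ e ∈ rest \ t, (1 - p' e)) = (∏ e ∈ t, p e) * ∏ e ∈ rest \ t, (1 - p e) := by
    have hmem : ∀ e ∈ rest, e ∈ latticeLayer m c ∧ e ≠ eL ∧ e ≠ eR := fun e he => by
      rw [hrest] at he
      exact ⟨Finset.mem_of_mem_erase (Finset.mem_of_mem_erase he),
        (Finset.mem_erase.1 (Finset.mem_erase.1 he).2).1, (Finset.mem_erase.1 he).1⟩
    have h1 : ∏ e ∈ t, p' e = ∏ e ∈ t, p e :=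
      Finset.prod_congr rfl fun e he =>
        hpp' e (hmem e (hts he)).1 (hmem e (hts he)).2.1 (hmem e (hts he)).2.2
    have h2 : ∏ e ∈ rest \ t, (1 - p' e) = ∏ e ∈ rest \ t, (1 - p e) :=
      Finset.prod_congr rfl fun e he => by
        rw [hpp' e (hmem e (Finset.sdiff_subset he)).1 (hmem e (Finset.sdiff_subset he)).2.1
          (hmem e (Finset.sdiff_subset he)).2.2]
    rw [h1, h2]
  -- the local relations
  have r1 := cpIsolate_colUpdate_bridge_open_open (c := c) (P := P) hB hP hWj
  have r2 := cpIsolate_colUpdate_bridge_not_both (c := c) (P := P) hB hWj true false (by simp)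
  have r3 := cpIsolate_colUpdate_bridge_not_both (c := c) (P := P) hB hWj false true (by simp)
  have r4 := cpIsolate_colUpdate_bridge_not_both (c := c) (P := P) hB hWj false false (by simp)
  rw [bridgeEdges_false_false hB] at r4
  have r5 := colUpdate_cpJoin_bridge (c := c) (P := P) hB hP true true (Or.inl rfl)
  have r6 := colUpdate_cpJoin_bridge (c := c) (P := P) hB hP true false (Or.inl rfl)
  have r7 := colUpdate_cpJoin_bridge (c := c) (P := P) hB hP false true (Or.inr rfl)
  simp only [r1, r2, r3, r4, r5, r6, r7, hw, hL', hR']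
  linear_combination (((∏ e ∈ t, p e) * ∏ e ∈ rest \ t, (1 - p e)) *
    ((if colUpdate m c P (bridgeSiteEdges (edgeFn m c t) uL uR j true true) = P'' then (1 : K) else 0) -
      (if colUpdate m c P (edgeFn m c t) = P'' then (1 : K) else 0))) * hαβ

end InterlaceBridge

/-! ### The fork decomposition of a weighted layer sum -/

section ForkDecomp

variable {K : Type*} [Field K] {c : ℤ} {v nL nR : Fin (m + 1)}

/-- **Splitting off the two edges at an old site.** The fork analogue of
`sum_powerset_bridge_decomp`. [folklore] -/
theorem sum_powerset_fork_decomp (hne : nL ≠ nR)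
    (hL : s(colSite c v, colSite (c + 1) nL) ∈ latticeLayer m c)
    (hR : s(colSite c v, colSite (c + 1) nR) ∈ latticeLayer m c)
    (honly : ∀ j' : Fin (m + 1), s(colSite c v, colSite (c + 1) j') ∈ latticeLayer m c → j' = nL ∨ j' = nR)
    (p : Sym2 (Site 2) → K) (Φ : (Fin (m + 1) → Fin (m + 1) → Bool) → K) :
    ∑ U ∈ (latticeLayer m c).powerset,
        Φ (edgeFn m c U) * ((∏ e ∈ U, p e) * ∏ e ∈ latticeLayer m c \ U, (1 - p e)) =
      ∑ t ∈ (((latticeLayer m c).erase s(colSite c v, colSite (c + 1) nL)).erase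
          s(colSite c v, colSite (c + 1) nR)).powerset,
        ((∏ e ∈ t, p e) * ∏ e ∈ (((latticeLayer m c).erase s(colSite c v, colSite (c + 1) nL)).erase
          s(colSite c v, colSite (c + 1) nR)) \ t, (1 - p e)) *
        (Φ (forkSiteEdges (edgeFn m c t) v nL nR true true) *
            (p s(colSite c v, colSite (c + 1) nL) * p s(colSite c v, colSite (c + 1) nR)) +
          Φ (forkSiteEdges (edgeFn m c t) v nL nR true false) *
            (p s(colSite c v, colSite (c + 1) nL) * (1 - p s(colSite c v, colSite (c + 1) nR))) +
          Φ (forkSiteEdges (edgeFn m c t) v nL nR false true) *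
            ((1 - p s(colSite c v, colSite (c + 1) nL)) * p s(colSite c v, colSite (c + 1) nR)) +
          Φ (edgeFn m c t) *
            ((1 - p s(colSite c v, colSite (c + 1) nL)) * (1 - p s(colSite c v, colSite (c + 1) nR)))) := by
  classical
  set eL := s(colSite c (v : ℕ), colSite (c + 1) (nL : ℕ)) with heL
  set eR := s(colSite c (v : ℕ), colSite (c + 1) (nR : ℕ)) with heR
  set rest := ((latticeLayer m c).erase eL).erase eR with hrest
  have hLR : eL ≠ eR := fun h => hne (Prod.ext_iff.1 (mk_colSite_injective (m := m) c
    (a₁ := (v, nL)) (a₂ := (v, nR)) h)).2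
  have heRrest : eR ∉ rest := Finset.notMem_erase _ _
  have heLrest : eL ∉ rest := fun h => (Finset.mem_erase.1 (Finset.mem_erase.1 h).2).1 rfl |>.elim
  have heLrest' : eL ∉ insert eR rest := by simp [hLR, heLrest]
  have hlayer : latticeLayer m c = insert eL (insert eR rest) := by
    rw [hrest, Finset.insert_erase (Finset.mem_erase.2 ⟨hLR.symm, hR⟩), Finset.insert_erase hL]
  -- no edge of `rest` at `v`
  have hrest_j : ∀ t ⊆ rest, ∀ j' : Fin (m + 1), edgeFn m c t v j' = false := by
    intro t ht j'
    simp only [edgeFn, decide_eq_false_iff_not]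
    intro hmem
    have hl : s(colSite c (v : ℕ), colSite (c + 1) (j' : ℕ)) ∈ latticeLayer m c := by
      have := ht hmem
      rw [hrest] at this
      exact Finset.mem_of_mem_erase (Finset.mem_of_mem_erase this)
    have ht' := ht hmem
    rw [hrest] at ht'
    rcases honly j' hl with rfl | rfl
    · exact (Finset.mem_erase.1 (Finset.mem_erase.1 ht').2).1 rfl
    · exact (Finset.mem_erase.1 ht').1 rfl
  rw [hlayer, Finset.sum_powerset_insert (β := K) heLrest', Finset.sum_powerset_insert (β := K) heRrest,
    Finset.sum_powerset_insert (β := K) heRrest, ← Finset.sum_add_distrib, ← Finset.sum_add_distrib,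
    ← Finset.sum_add_distrib]
  refine Finset.sum_congr rfl fun t ht => ?_
  have hts : t ⊆ rest := Finset.mem_powerset.1 ht
  have heLt : eL ∉ t := fun h => heLrest (hts h)
  have heRt : eR ∉ t := fun h => heRrest (hts h)
  have heLt' : eL ∉ insert eR t := by simp [hLR, heLt]
  have hB : IsForkSite (edgeFn m c t) v nL nR := ⟨hne, hrest_j t hts⟩
  -- the four edge layers
  have e_tt : edgeFn m c (insert eL (insert eR t)) = forkSiteEdges (edgeFn m c t) v nL nR true true := by
    rw [Finset.insert_comm, heR, edgeFn_insert, heL, edgeFn_insert]; rfl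
  have e_tf : edgeFn m c (insert eL t) = forkSiteEdges (edgeFn m c t) v nL nR true false := by
    rw [heL, edgeFn_insert]
    unfold forkSiteEdges
    refine (setEdge_eq_self ?_).symm
    rw [setEdge_of_ne _ _ (fun h => hne h.2.symm)]
    exact hB.noEdge nR
  have e_ft : edgeFn m c (insert eR t) = forkSiteEdges (edgeFn m c t) v nL nR false true := by
    rw [heR, edgeFn_insert]
    unfold forkSiteEdges
    rw [setEdge_eq_self (hB.noEdge nL)]
  -- the four complements
  have s_tt : insert eL (insert eR rest) \ insert eL (insert eR t) = rest \ t := by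
    ext e
    simp only [Finset.mem_sdiff, Finset.mem_insert]
    constructor
    · rintro ⟨h1, h2⟩
      simp only [not_or] at h2
      exact ⟨h1.resolve_left h2.1 |>.resolve_left h2.2.1, h2.2.2⟩
    · rintro ⟨h1, h2⟩
      refine ⟨Or.inr (Or.inr h1), ?_⟩
      rintro (rfl | rfl | h)
      · exact heLrest h1
      · exact heRrest h1
      · exact h2 h
  have s_tf : insert eL (insert eR rest) \ insert eL t = insert eR (rest \ t) := by
    ext e
    simp only [Finset.mem_sdiff, Finset.mem_insert]
    constructor
    · rintro ⟨h1, h2⟩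
      simp only [not_or] at h2
      rcases h1 with rfl | rfl | h1
      · exact absurd rfl h2.1
      · exact Or.inl rfl
      · exact Or.inr ⟨h1, h2.2⟩
    · rintro (rfl | ⟨h1, h2⟩)
      · exact ⟨Or.inr (Or.inl rfl), by rintro (h | h); exact hLR h.symm; exact heRt h⟩
      · refine ⟨Or.inr (Or.inr h1), ?_⟩
        rintro (rfl | h)
        · exact heLrest h1
        · exact h2 h
  have s_ft : insert eL (insert eR rest) \ insert eR t = insert eL (rest \ t) := by
    ext e
    simp only [Finset.mem_sdiff, Finset.mem_insert]
    constructor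
    · rintro ⟨h1, h2⟩
      simp only [not_or] at h2
      rcases h1 with rfl | rfl | h1
      · exact Or.inl rfl
      · exact absurd rfl h2.1
      · exact Or.inr ⟨h1, h2.2⟩
    · rintro (rfl | ⟨h1, h2⟩)
      · exact ⟨Or.inl rfl, by rintro (h | h); exact hLR h; exact heLt h⟩
      · refine ⟨Or.inr (Or.inr h1), ?_⟩
        rintro (rfl | h)
        · exact heRrest h1
        · exact h2 h
  have s_ff : insert eL (insert eR rest) \ t = insert eL (insert eR (rest \ t)) := by
    ext e
    simp only [Finset.mem_sdiff, Finset.mem_insert]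
    constructor
    · rintro ⟨rfl | rfl | h1, h2⟩
      · exact Or.inl rfl
      · exact Or.inr (Or.inl rfl)
      · exact Or.inr (Or.inr ⟨h1, h2⟩)
    · rintro (rfl | rfl | ⟨h1, h2⟩)
      · exact ⟨Or.inl rfl, heLt⟩
      · exact ⟨Or.inr (Or.inl rfl), heRt⟩
      · exact ⟨Or.inr (Or.inr h1), h2⟩
  have heRrt : eR ∉ rest \ t := fun h => heRrest (Finset.mem_sdiff.1 h).1
  have heLrt : eL ∉ rest \ t := fun h => heLrest (Finset.mem_sdiff.1 h).1
  have heLrt' : eL ∉ insert eR (rest \ t) := by simp [hLR, heLrt]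
  rw [e_tt, e_tf, e_ft, s_tt, s_tf, s_ft, s_ff, Finset.prod_insert heLt', Finset.prod_insert heRt,
    Finset.prod_insert heLt, Finset.prod_insert heLrt', Finset.prod_insert heRrt, Finset.prod_insert heLrt]
  ring

end ForkDecomp


/-! ### Single-row interlacing at an old site (case II) -/

section InterlaceFork

variable {K : Type*} [Field K] {c : ℤ} {v nL nR : Fin (m + 1)}

/-- **Single-row interlacing at an old site (case II), kernel form.** Let the old site `v` of the
layer `c → c+1` have the new neighbours `nL ≠ nR` and no other lattice edge. For edge weights
`p, p'` that agree off the two edges at `v` and are swapped-and-complemented on them, and scalars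
with `α (p_L p_R - (1-p_L)(1-p_R)) - β (1 - (1-p_L)(1-p_R)) = 0`, one has, for every VALID input
pattern `P` and every output pattern `P''`,
`α (T_p - T_{p'})(P → P'') = β ( (T_p ∘ join_{nL nR})(P → P'') - T_{p'}(iso_v P → P'') )`
— Lemma 3.2 for one row at a level hosting an old site. [cite: IkhlefPonsaing2012, Lemma 3.2] -/
theorem ipTransferW_interlace_fork (hne : nL ≠ nR)
    (hL : s(colSite c v, colSite (c + 1) nL) ∈ latticeLayer m c)
    (hR : s(colSite c v, colSite (c + 1) nR) ∈ latticeLayer m c)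
    (honly : ∀ j' : Fin (m + 1), s(colSite c v, colSite (c + 1) j') ∈ latticeLayer m c → j' = nL ∨ j' = nR)
    {P : ColPattern m} (hP : IsValid c P)
    {p p' : Sym2 (Site 2) → K}
    (hpp' : ∀ e ∈ latticeLayer m c, e ≠ s(colSite c v, colSite (c + 1) nL) →
      e ≠ s(colSite c v, colSite (c + 1) nR) → p' e = p e)
    (hL' : p' s(colSite c v, colSite (c + 1) nL) = 1 - p s(colSite c v, colSite (c + 1) nR))
    (hR' : p' s(colSite c v, colSite (c + 1) nR) = 1 - p s(colSite c v, colSite (c + 1) nL))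
    {α β : K}
    (hαβ : α * (p s(colSite c v, colSite (c + 1) nL) * p s(colSite c v, colSite (c + 1) nR) -
        (1 - p s(colSite c v, colSite (c + 1) nL)) * (1 - p s(colSite c v, colSite (c + 1) nR))) -
      β * (1 - (1 - p s(colSite c v, colSite (c + 1) nL)) * (1 - p s(colSite c v, colSite (c + 1) nR))) = 0)
    (P'' : ColPattern m) :
    α * (ipTransferW m c p P P'' - ipTransferW m c p' P P'') =
      β * ((∑ P' ∈ Finset.univ.filter (fun P' => cpJoin nL nR P' = P''), ipTransferW m c p P P') -
        ipTransferW m c p' (cpIsolate v P) P'') := by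
  rw [ipTransferW_eq_sum_boole c p P, ipTransferW_eq_sum_boole c p' P, ipTransferW_eq_sum_boole c p',
    sum_filter_ipTransferW_eq,
    sum_powerset_fork_decomp hne hL hR honly p (fun E => if colUpdate m c P E = P'' then (1 : K) else 0),
    sum_powerset_fork_decomp hne hL hR honly p' (fun E => if colUpdate m c P E = P'' then (1 : K) else 0),
    sum_powerset_fork_decomp hne hL hR honly p
      (fun E => if cpJoin nL nR (colUpdate m c P E) = P'' then (1 : K) else 0),
    sum_powerset_fork_decomp hne hL hR honly p'
      (fun E => if colUpdate m c (cpIsolate v P) E = P'' then (1 : K) else 0),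
    ← Finset.sum_sub_distrib, ← Finset.sum_sub_distrib, Finset.mul_sum, Finset.mul_sum]
  set eL := s(colSite c (v : ℕ), colSite (c + 1) (nL : ℕ)) with heL
  set eR := s(colSite c (v : ℕ), colSite (c + 1) (nR : ℕ)) with heR
  set rest := ((latticeLayer m c).erase eL).erase eR with hrest
  refine Finset.sum_congr rfl fun t ht => ?_
  have hts : t ⊆ rest := Finset.mem_powerset.1 ht
  -- no edge of `t` at `v`
  have hB : IsForkSite (edgeFn m c t) v nL nR := by
    refine ⟨hne, fun j' => ?_⟩
    simp only [edgeFn, decide_eq_false_iff_not]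
    intro hmem
    have ht' := hts hmem
    rw [hrest] at ht'
    have hl : s(colSite c (v : ℕ), colSite (c + 1) (j' : ℕ)) ∈ latticeLayer m c :=
      Finset.mem_of_mem_erase (Finset.mem_of_mem_erase ht')
    rcases honly j' hl with rfl | rfl
    · exact (Finset.mem_erase.1 (Finset.mem_erase.1 ht').2).1 rfl
    · exact (Finset.mem_erase.1 ht').1 rfl
  -- the weights of `t` agree
  have hw : ((∏ e ∈ t, p' e) * ∏ e ∈ rest \ t, (1 - p' e)) = (∏ e ∈ t, p e) * ∏ e ∈ rest \ t, (1 - p e) := by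
    have hmem : ∀ e ∈ rest, e ∈ latticeLayer m c ∧ e ≠ eL ∧ e ≠ eR := fun e he => by
      rw [hrest] at he
      exact ⟨Finset.mem_of_mem_erase (Finset.mem_of_mem_erase he),
        (Finset.mem_erase.1 (Finset.mem_erase.1 he).2).1, (Finset.mem_erase.1 he).1⟩
    have h1 : ∏ e ∈ t, p' e = ∏ e ∈ t, p e :=
      Finset.prod_congr rfl fun e he =>
        hpp' e (hmem e (hts he)).1 (hmem e (hts he)).2.1 (hmem e (hts he)).2.2
    have h2 : ∏ e ∈ rest \ t, (1 - p' e) = ∏ e ∈ rest \ t, (1 - p e) :=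
      Finset.prod_congr rfl fun e he => by
        rw [hpp' e (hmem e (Finset.sdiff_subset he)).1 (hmem e (Finset.sdiff_subset he)).2.1
          (hmem e (Finset.sdiff_subset he)).2.2]
    rw [h1, h2]
  -- the local relations
  have r1 := colUpdate_cpIsolate_fork_open_open (c := c) (P := P) hB hP
  have r2 := colUpdate_cpIsolate_fork_not_both (c := c) (P := P) hB hP true false (by simp)
  have r3 := colUpdate_cpIsolate_fork_not_both (c := c) (P := P) hB hP false true (by simp)
  have r4 := colUpdate_cpIsolate_fork_not_both (c := c) (P := P) hB hP false false (by simp)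
  rw [forkSiteEdges_false_false hB] at r4
  have r5 := cpJoin_colUpdate_fork (c := c) (P := P) hB true true (Or.inl rfl)
  have r6 := cpJoin_colUpdate_fork (c := c) (P := P) hB true false (Or.inl rfl)
  have r7 := cpJoin_colUpdate_fork (c := c) (P := P) hB false true (Or.inr rfl)
  simp only [r1, r2, r3, r4, r5, r6, r7, hw, hL', hR']
  linear_combination (((∏ e ∈ t, p e) * ∏ e ∈ rest \ t, (1 - p e)) *
    ((if colUpdate m c P (forkSiteEdges (edgeFn m c t) v nL nR true true) = P'' then (1 : K) else 0) -
      (if colUpdate m c P (edgeFn m c t) = P'' then (1 : K) else 0))) * hαβ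

end InterlaceFork

/-! ### The exchange identity of the tile weights -/

section Exchange

variable {K : Type*} [Field K]

/-- The cleared form of the exchange identity: with `[x] = x - x⁻¹` and `q³ = 1`,
`[qb/a]([qa][b] - [qb][a]) + [a/b]([q/a][q/b] - [qa][b]) = 0`. [folklore] -/
theorem qbr_exchange_identity {q a b : K} (hq : q ^ 3 = 1) (ha : a ≠ 0) (hb : b ≠ 0) :
    qbr (q * b / a) * (qbr (q * a) * qbr b - qbr (q * b) * qbr a) +
      qbr (a / b) * (qbr (q / a) * qbr (q / b) - qbr (q * a) * qbr b) = 0 := by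
  have hq0 : q ≠ 0 := by rintro rfl; norm_num at hq
  have key : (qbr (q * b / a) * (qbr (q * a) * qbr b - qbr (q * b) * qbr a) +
      qbr (a / b) * (qbr (q / a) * qbr (q / b) - qbr (q * a) * qbr b)) * (a ^ 2 * b ^ 2 * q ^ 2) =
      (q ^ 3 - 1) * (q * b ^ 4 + a ^ 4 - a ^ 2 * b ^ 2 - q * a ^ 2 * b ^ 2 + q * a ^ 2 + a ^ 2 * b ^ 4 -
        a ^ 4 * b ^ 2 - q * b ^ 2) := by
    unfold qbr
    field_simp
    ring
  have hne : a ^ 2 * b ^ 2 * q ^ 2 ≠ 0 := by positivity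
  have := mul_eq_zero.1 (key.trans (by rw [hq, sub_self, zero_mul]))
  exact this.resolve_right hne

/-- **The exchange identity of IP12's tile weights** (`A(x) = [qx]/[q/x]`, `B(x) = [x]/[q/x]`, `q³ = 1`):
`[qb/a] (A(a)B(b) - A(b)B(a)) + [a/b] (1 - A(a)B(b)) = 0` — the scalar identity behind the
Yang–Baxter push of `Ř(a/b)` through two consecutive tiles with rapidity ratios `a, b`.
[cite: IkhlefPonsaing2012, Lemma 3.2] -/
theorem ipWt_exchange_identity {q a b : K} (hq : q ^ 3 = 1) (ha : a ≠ 0) (hb : b ≠ 0)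
    (hqa : qbr (q / a) ≠ 0) (hqb : qbr (q / b) ≠ 0) :
    qbr (q * b / a) * (ipWtA q a * ipWtB q b - ipWtA q b * ipWtB q a) +
      qbr (a / b) * (1 - ipWtA q a * ipWtB q b) = 0 := by
  have h := qbr_exchange_identity hq ha hb
  unfold ipWtA ipWtB
  rw [div_mul_div_comm, div_mul_div_comm, mul_comm (qbr (q / b)) (qbr (q / a)), ← sub_div,
    one_sub_div (mul_ne_zero hqa hqb), mul_div_assoc', mul_div_assoc', ← add_div, div_eq_zero_iff]
  exact Or.inl h

end Exchange

end Literature.Probability.Percolation
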